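import Summits.QuantumFields.YangMills.Theorems.VirialFluxGapFixTubeFloor
import Summits.QuantumFields.YangMills.Theorems.LuscherReductionRunningReductionTraceFormulaAveraging
import HarnessLib

/-!
# The off-tube floor with the FAITHFUL orbit indexing (`s k₀ = false`) — `hfloor` of ✓`sharpTwistedLaplace_of_fixTubes` for `ι = {s // s k₀ = false}`
# (item (R5′) of the DIRECT Laplace road to ⟨stmt-QuantumFields-24204⟩ `VirialFluxGap.SharpTwistedLaplace`; requested by the assembler w3 g57)

Helper module (free-hands work of width seat ym-line-sfw-p2-w2 g50, cell ym-idea-1; `--supports 24204`).  The eight sign classes label four zero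
orbits: conjugation by `C₀` turns the zero parametrisation `(s, k′)` of ✓`ringDeficit_treeGauge_eq_zero_iff` into `(s ⊕ z, k′·C₀)`
(✓`reference_twistEater_relations`: `C₀ w_s(k) C₀⁻¹ = centreElem(z_k)·w_s(k) = w_{s⊕z}(k)`).  Hence every zero has a parametrisation by a
REPRESENTATIVE class (`s k₀ = false`, as `z k₀ = true`), and the covering ∕ tube ∕ floor theorems of ✓`VirialFluxGapFixTubeCovering` and
✓`VirialFluxGapFixTubeFloor` hold with the class restricted to representatives:
* `exists_zero_param_rep`; `exists_conj_anchorSlice_of_zero_param` (the covering theorem from a GIVEN parametrisation — same proof as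
  ✓`exists_conj_anchorSlice_of_ringDistSq_lt`); `exists_conj_anchorSlice_of_ringDistSq_lt_rep`;
* ★★ `exists_mem_fixTube_of_ringDistSq_lt_rep` and ★★ `ringDeficit_fix_floor_off_repTubes`: OFF the four representative tubes
  `F_fix ≥ min((KL^q)⁻¹, ρ/(1010L⁶KL^q))`.
Everything here is PROVED; no definitions (namespace `Summit.QuantumFields.YangMills.Theorems.VirialFluxGap.AnchorSlice`).

HONEST FRAMING: bookkeeping; ⟨24204⟩, ⟨24319⟩, ⟨22884⟩ and every rung stay OPEN; the Yang–Mills mass gap (Clay) is NOT touched; no summit is proved by a line.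

## References
* G. E. Bredon, *Introduction to Compact Transformation Groups* (1972), Ch. II §§4–5. [Bredon1972]
* A. Gonzalez-Arroyo, C. P. Korthals Altes, Nucl. Phys. B311 (1988), §2. [GonzalezarroyoAltes1988]
-/

set_option autoImplicit false

noncomputable section

open scoped Quaternion RealInnerProductSpace BigOperators
open NormedSpace Metric Set WithLp
open Literature.MathematicalPhysics.QuantumFieldTheory hiding SU2 su2Quat_mul
open Literature.MathematicalPhysics.QuantumLattice
open Literature.MathematicalPhysics.QuantumFieldTheory.Balaban1983to89.T4HaarSU2Translate (su2Quat_mul)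
open Literature.MathematicalPhysics.QuantumFieldTheory.Balaban1983to89.T4WilsonLinkAffine (su2Quat_inv)
open Literature.MathematicalPhysics.QuantumFieldTheory.Balaban1983to89.T4HaarSU2ExpChart
open Literature.MathematicalPhysics.QuantumFieldTheory.Balaban1983to89.T4ExpWindowSmallField (logVec norm_logVec expPoint_logVec)
open Summit.QuantumFields.YangMills.Theorems.FemtoTransferGap
open Summit.QuantumFields.YangMills.Theorems.FemtoTransferGap.TT
open Summit.QuantumFields.YangMills.Theorems.FemtoTransferGap.TwoLattice
open Summit.QuantumFields.YangMills.Theorems.FemtoTransferGap.TwoLattice.Flat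
open Summit.QuantumFields.YangMills.Theorems.ToronValleyVolume.Lojasiewicz
open Summit.QuantumFields.YangMills.Theorems.TwistEaterVolume.Quadratic
open Summit.QuantumFields.YangMills.Theorems.VirialFluxGap.RingDeficit
open Summit.QuantumFields.YangMills.Theorems.VirialFluxGap.FixSplit
open Summit.QuantumFields.YangMills.Theorems.QuantitativeLaplace (not_treeEdge_wrap su2Quat_centreElem)

namespace Summit.QuantumFields.YangMills.Theorems.VirialFluxGap.AnchorSlice

variable {L : ℕ} [NeZero L]

/-! ## §1 Every zero has a representative parametrisation -/

/-- ★ **Representative parametrisation of a zero**: the class can be taken with `s k₀ = false` (replace `(s, k′)` by `(s ⊕ z, k′·C₀)` if needed).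
[cite: GonzalezarroyoAltes1988, §2] -/
theorem exists_zero_param_rep (hL : 2 ≤ L) (z : Fin 3 → Bool) (hz : z ≠ fun _ => false) {k₀ : Fin 3} (hk₀ : z k₀ = true)
    {lam : Site 3 L → SU2} (hlamc : ∀ x, lam x ∈ Subgroup.center SU2) (hlam0 : lam 0 = 1)
    (hlamflip : ∀ (x : Site 3 L) (k : Fin 3), (x k = 0 ∨ x k = -1) → lam (x.shift k) = lam x * centreElem (z k))
    (hlamstay : ∀ (x : Site 3 L) (k : Fin 3), x k ≠ 0 → x k ≠ -1 → lam (x.shift k) = lam x)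
    {N₀ C₀ : SU2} (hN : (su2Quat N₀).re = 0) (hC : (su2Quat C₀).re = 0)
    (hNC : (su2Quat N₀).imI * (su2Quat C₀).imI + (su2Quat N₀).imJ * (su2Quat C₀).imJ + (su2Quat N₀).imK * (su2Quat C₀).imK = 0)
    (x' : (OffIdx L → SU2) × ((Fin (2 * L - 1) → GaugeConfig 3 L SU2) × (Site 3 L → SU2)))
    (hx' : ringDeficit L z ((Fin.cons (glue x'.1) x'.2.1 : Fin (2 * L - 1 + 1) → GaugeConfig 3 L SU2), x'.2.2) = 0) :
    ∃ (s : Fin 3 → Bool) (k' : SU2), s k₀ = false ∧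
      glue x'.1 = gaugeTransform (fun _ : Site 3 L => k') (combFlat fun i => centreElem (s i) * (if z i then N₀ else 1)) ∧
      (∀ j, x'.2.1 j = gaugeTransform (fun _ : Site 3 L => k') (combFlat fun i => centreElem (s i) * (if z i then N₀ else 1))) ∧
      x'.2.2 = fun x => k' * (lam x * C₀) * k'⁻¹ := by
  obtain ⟨s, k', hw', hf', hg'⟩ := (ringDeficit_treeGauge_eq_zero_iff hL z hz hlamc hlam0 hlamflip hlamstay hN hC hNC x'.1 x'.2.1 x'.2.2).mp hx'
  cases hs0 : s k₀
  · exact ⟨s, k', hs0, hw', hf', hg'⟩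
  · -- flip the class with `C₀`
    obtain ⟨-, htw⟩ := reference_twistEater_relations hN hC hNC z (fun a => xor (s a) (z a))
    have hflip : gaugeTransform (fun _ : Site 3 L => k' * C₀) (combFlat fun i => centreElem (xor (s i) (z i)) * (if z i then N₀ else 1)) =
        gaugeTransform (fun _ : Site 3 L => k') (combFlat fun i => centreElem (s i) * (if z i then N₀ else 1)) := by
      funext e
      show k' * C₀ * combFlat (fun i => centreElem (xor (s i) (z i)) * (if z i then N₀ else 1)) e * (k' * C₀)⁻¹ =
        k' * combFlat (fun i => centreElem (s i) * (if z i then N₀ else 1)) e * k'⁻¹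
      rw [combFlat_apply, combFlat_apply]
      by_cases he : e.1 e.2 = -1
      · rw [if_pos he, if_pos he]
        have h := htw e.2
        have e2 : centreElem (z e.2) * (centreElem (xor (s e.2) (z e.2)) * (if z e.2 then N₀ else 1)) =
            centreElem (s e.2) * (if z e.2 then N₀ else 1) := by
          rw [← mul_assoc, centreElem_mul]
          congr 2
          cases z e.2 <;> cases s e.2 <;> rfl
        rw [mul_inv_rev, show k' * C₀ * (centreElem (xor (s e.2) (z e.2)) * (if z e.2 then N₀ else 1)) * (C₀⁻¹ * k'⁻¹) =
          k' * (C₀ * (centreElem (xor (s e.2) (z e.2)) * (if z e.2 then N₀ else 1)) * C₀⁻¹) * k'⁻¹ by group, h, e2]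
      · rw [if_neg he, if_neg he, mul_inv_rev]; group
    have hseam : (fun x => k' * C₀ * (lam x * C₀) * (k' * C₀)⁻¹) = fun x => k' * (lam x * C₀) * k'⁻¹ := by
      funext x
      have hc : lam x * C₀ = C₀ * lam x := ((hlamc x).comm C₀).symm.symm
      rw [mul_inv_rev]
      calc k' * C₀ * (lam x * C₀) * (C₀⁻¹ * k'⁻¹) = k' * (C₀ * lam x) * (C₀ * C₀⁻¹) * k'⁻¹ := by group
        _ = k' * (lam x * C₀) * k'⁻¹ := by rw [mul_inv_cancel, mul_one, ← hc]
    refine ⟨fun a => xor (s a) (z a), k' * C₀, by simp [hs0, hk₀], ?_, fun j => ?_, ?_⟩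
    · rw [hflip]; exact hw'
    · rw [hflip]; exact hf' j
    · rw [hseam]; exact hg'

/-! ## §2 The covering theorem from a given parametrisation of the zero -/

/-- ★★ The covering theorem ✓`exists_conj_anchorSlice_of_ringDistSq_lt` from a GIVEN parametrisation `(s, k′)` of the zero `x′` (same proof).
[cite: Bredon1972, Ch. II §§4–5] -/
theorem exists_conj_anchorSlice_of_zero_param (hL : 2 ≤ L) (z : Fin 3 → Bool) {k₀ : Fin 3} (hk₀ : z k₀ = true)
    {lam : Site 3 L → SU2} (hlam0 : lam 0 = 1) {N₀ C₀ : SU2}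
    {ωC ωN ωX : EuclideanSpace ℝ (Fin 3)} (hCω : ‖ωC‖ = 1) (hNω : ‖ωN‖ = 1) (hCN : ⟪ωC, ωN⟫ = 0) (hX : imQuat ωX = imQuat ωC * imQuat ωN)
    (hC₀ : su2Quat C₀ = imQuat ωC) (hN₀ : su2Quat N₀ = imQuat ωN)
    (x x' : (OffIdx L → SU2) × ((Fin (2 * L - 1) → GaugeConfig 3 L SU2) × (Site 3 L → SU2)))
    {s : Fin 3 → Bool} {k' : SU2}
    (hw' : glue x'.1 = gaugeTransform (fun _ : Site 3 L => k') (combFlat fun i => centreElem (s i) * (if z i then N₀ else 1)))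
    (hf' : ∀ j, x'.2.1 j = gaugeTransform (fun _ : Site 3 L => k') (combFlat fun i => centreElem (s i) * (if z i then N₀ else 1)))
    (hg' : x'.2.2 = fun x => k' * (lam x * C₀) * k'⁻¹)
    {ρ : ℝ} (hρ : ρ ≤ 1 / 1600)
    (hD : (∑ i : Fin (2 * L - 1 + 1), (6 * (L : ℝ) ^ 3 - timeCoupling su2Rep
        ((Fin.cons (glue x.1) x.2.1 : Fin (2 * L - 1 + 1) → GaugeConfig 3 L SU2) i)
        ((Fin.cons (glue x'.1) x'.2.1 : Fin (2 * L - 1 + 1) → GaugeConfig 3 L SU2) i))) +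
        ∑ y : Site 3 L, (2 - ((su2Rep (x.2.2 y * (x'.2.2 y)⁻¹)).trace).re) < ρ) :
    ∃ (k : SU2) (t b₁ b₂ : ℝ), |t| < Real.pi / 2 ∧ |Real.sin t| ≤ Real.sqrt ρ ∧ b₁ ^ 2 + b₂ ^ 2 ≤ 225 * ρ ∧
      k * x.2.2 0 * k⁻¹ = seamSlice ωC C₀ t ∧
      k * x.1 ⟨(((fun _ => (-1 : ZMod L)), k₀) : Edge 3 L), not_treeEdge_wrap hL k₀⟩ * k⁻¹ = linkSlice ωN ωX (centreElem (s k₀) * N₀) b₁ b₂ ∧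
      (∀ i : OffIdx L, ‖su2Quat (k * x.1 i * k⁻¹) - su2Quat (combFlat (fun a => centreElem (s a) * (if z a then N₀ else 1)) i.1)‖ ≤ 81 * Real.sqrt ρ) ∧
      (∀ (j : Fin (2 * L - 1)) (e : Edge 3 L),
        ‖su2Quat (k * x.2.1 j e * k⁻¹) - su2Quat (combFlat (fun a => centreElem (s a) * (if z a then N₀ else 1)) e)‖ ≤ 81 * Real.sqrt ρ) ∧
      (∀ y : Site 3 L, ‖su2Quat (k * x.2.2 y * k⁻¹) - su2Quat (lam y * C₀)‖ ≤ 81 * Real.sqrt ρ) := by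
  set W : GaugeConfig 3 L SU2 := combFlat (fun a => centreElem (s a) * (if z a then N₀ else 1)) with hW
  set e₀ : Edge 3 L := (((fun _ => (-1 : ZMod L)), k₀) : Edge 3 L) with he₀
  have he₀t : ¬ treeEdge e₀ = true := not_treeEdge_wrap hL k₀
  have hρ0 : 0 ≤ ρ := by
    have h0 : 0 ≤ (∑ i : Fin (2 * L - 1 + 1), (6 * (L : ℝ) ^ 3 - timeCoupling su2Rep
        ((Fin.cons (glue x.1) x.2.1 : Fin (2 * L - 1 + 1) → GaugeConfig 3 L SU2) i)
        ((Fin.cons (glue x'.1) x'.2.1 : Fin (2 * L - 1 + 1) → GaugeConfig 3 L SU2) i))) +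
        ∑ y : Site 3 L, (2 - ((su2Rep (x.2.2 y * (x'.2.2 y)⁻¹)).trace).re) := by
      have := norm_sq_site_le_ringDistSq x x' 0; nlinarith [sq_nonneg ‖su2Quat (x.2.2 0) - su2Quat (x'.2.2 0)‖]
    linarith
  have hsρ : Real.sqrt ρ ≤ 1 / 40 := by
    calc Real.sqrt ρ ≤ Real.sqrt (1 / 1600) := Real.sqrt_le_sqrt hρ
      _ = 1 / 40 := by rw [show (1 / 1600 : ℝ) = (1 / 40) ^ 2 by norm_num, Real.sqrt_sq (by norm_num)]
  -- the coordinates of the zero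
  have hx'1 : ∀ i : OffIdx L, x'.1 i = k' * W i.1 * k'⁻¹ := by
    intro i
    have h := congrFun hw' i.1
    rw [glue_apply_of_not_tree _ i.2] at h
    exact h
  have hx'2 : ∀ (j : Fin (2 * L - 1)) (e : Edge 3 L), x'.2.1 j e = k' * W e * k'⁻¹ := fun j e => by
    have h := congrFun (hf' j) e; exact h
  have hx'3 : ∀ y : Site 3 L, x'.2.2 y = k' * (lam y * C₀) * k'⁻¹ := fun y => congrFun hg' y
  -- per-coordinate distances `≤ √ρ` after conjugating by `k'⁻¹`
  have hdist1 : ∀ i : OffIdx L, ‖su2Quat (k'⁻¹ * x.1 i * k') - su2Quat (W i.1)‖ ≤ Real.sqrt ρ := by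
    intro i
    rw [norm_su2Quat_conj_inv_sub, ← hx'1 i]
    refine norm_le_sqrt_of_sq_le ?_ hD
    have h := norm_sq_link_le_ringDistSq x x' 0 i.1
    rw [Fin.cons_zero, Fin.cons_zero, glue_apply_of_not_tree _ i.2, glue_apply_of_not_tree _ i.2] at h
    exact h
  have hdist2 : ∀ (j : Fin (2 * L - 1)) (e : Edge 3 L), ‖su2Quat (k'⁻¹ * x.2.1 j e * k') - su2Quat (W e)‖ ≤ Real.sqrt ρ := by
    intro j e
    rw [norm_su2Quat_conj_inv_sub, ← hx'2 j e]
    refine norm_le_sqrt_of_sq_le ?_ hD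
    have h := norm_sq_link_le_ringDistSq x x' j.succ e
    rw [Fin.cons_succ, Fin.cons_succ] at h
    exact h
  have hdist3 : ∀ y : Site 3 L, ‖su2Quat (k'⁻¹ * x.2.2 y * k') - su2Quat (lam y * C₀)‖ ≤ Real.sqrt ρ := by
    intro y
    rw [norm_su2Quat_conj_inv_sub, ← hx'3 y]
    exact norm_le_sqrt_of_sq_le (norm_sq_site_le_ringDistSq x x' y) hD
  -- the anchors
  have hWe₀ : W e₀ = centreElem (s k₀) * N₀ := by
    rw [hW, combFlat_apply, if_pos (show ((fun _ => (-1 : ZMod L)) : Site 3 L) k₀ = -1 from rfl)]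
    show centreElem (s k₀) * (if z k₀ then N₀ else 1) = centreElem (s k₀) * N₀
    rw [if_pos hk₀]
  have hNs : su2Quat (centreElem (s k₀) * N₀) = imQuat ωN ∨ su2Quat (centreElem (s k₀) * N₀) = -imQuat ωN := by
    rw [su2Quat_centreElem_mul, hN₀]
    cases s k₀
    · left; simp
    · right; simp
  have h1 : ‖su2Quat (k'⁻¹ * x.2.2 0 * k') - su2Quat C₀‖ ≤ Real.sqrt ρ := by
    have h := hdist3 0; rwa [hlam0, one_mul] at h
  have h2 : ‖su2Quat (k'⁻¹ * x.1 ⟨e₀, he₀t⟩ * k') - su2Quat (centreElem (s k₀) * N₀)‖ ≤ Real.sqrt ρ := by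
    have h := hdist1 ⟨e₀, he₀t⟩; rwa [hWe₀] at h
  obtain ⟨k'', t, b₁, b₂, hk''d, htπ, hsin, hb, hseam, hlink⟩ := exists_conj_anchor_slice_su2 hCω hNω hCN hX hC₀ hNs hsρ h1 h2
  -- assemble with `k = k'' k'⁻¹`
  have hconj : ∀ u : SU2, k'' * k'⁻¹ * u * (k'' * k'⁻¹)⁻¹ = k'' * (k'⁻¹ * u * k') * k''⁻¹ := fun u => by
    rw [mul_inv_rev, inv_inv]; noncomm_ring
  have hrest : ∀ u q : SU2, ‖su2Quat (k'⁻¹ * u * k') - su2Quat q‖ ≤ Real.sqrt ρ →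
      ‖su2Quat (k'' * (k'⁻¹ * u * k') * k''⁻¹) - su2Quat q‖ ≤ 81 * Real.sqrt ρ := by
    intro u q hu
    rw [su2Quat_mul, su2Quat_mul, su2Quat_inv]
    have h := norm_conj_sub_le (norm_su2Quat k'') (norm_su2Quat (k'⁻¹ * u * k')) (su2Quat q)
    linarith
  refine ⟨k'' * k'⁻¹, t, b₁, b₂, htπ, hsin, by nlinarith [hb, Real.sq_sqrt hρ0], ?_, ?_, fun i => ?_, fun j e => ?_, fun y => ?_⟩
  · rw [hconj]; exact hseam
  · rw [hconj]; exact hlink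
  · rw [hconj]; exact hrest _ _ (hdist1 i)
  · rw [hconj]; exact hrest _ _ (hdist2 j e)
  · rw [hconj]; exact hrest _ _ (hdist3 y)


/-- ★★ The covering theorem with a REPRESENTATIVE class (`s k₀ = false`). [cite: Bredon1972, Ch. II §§4–5] -/
theorem exists_conj_anchorSlice_of_ringDistSq_lt_rep (hL : 2 ≤ L) (z : Fin 3 → Bool) (hz : z ≠ fun _ => false) {k₀ : Fin 3} (hk₀ : z k₀ = true)
    {lam : Site 3 L → SU2} (hlamc : ∀ x, lam x ∈ Subgroup.center SU2) (hlam0 : lam 0 = 1)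
    (hlamflip : ∀ (x : Site 3 L) (k : Fin 3), (x k = 0 ∨ x k = -1) → lam (x.shift k) = lam x * centreElem (z k))
    (hlamstay : ∀ (x : Site 3 L) (k : Fin 3), x k ≠ 0 → x k ≠ -1 → lam (x.shift k) = lam x)
    {N₀ C₀ : SU2} (hN : (su2Quat N₀).re = 0) (hC : (su2Quat C₀).re = 0)
    (hNC : (su2Quat N₀).imI * (su2Quat C₀).imI + (su2Quat N₀).imJ * (su2Quat C₀).imJ + (su2Quat N₀).imK * (su2Quat C₀).imK = 0)
    {ωC ωN ωX : EuclideanSpace ℝ (Fin 3)} (hCω : ‖ωC‖ = 1) (hNω : ‖ωN‖ = 1) (hCN : ⟪ωC, ωN⟫ = 0) (hX : imQuat ωX = imQuat ωC * imQuat ωN)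
    (hC₀ : su2Quat C₀ = imQuat ωC) (hN₀ : su2Quat N₀ = imQuat ωN)
    (x x' : (OffIdx L → SU2) × ((Fin (2 * L - 1) → GaugeConfig 3 L SU2) × (Site 3 L → SU2)))
    (hx' : ringDeficit L z ((Fin.cons (glue x'.1) x'.2.1 : Fin (2 * L - 1 + 1) → GaugeConfig 3 L SU2), x'.2.2) = 0)
    {ρ : ℝ} (hρ : ρ ≤ 1 / 1600)
    (hD : (∑ i : Fin (2 * L - 1 + 1), (6 * (L : ℝ) ^ 3 - timeCoupling su2Rep
        ((Fin.cons (glue x.1) x.2.1 : Fin (2 * L - 1 + 1) → GaugeConfig 3 L SU2) i)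
        ((Fin.cons (glue x'.1) x'.2.1 : Fin (2 * L - 1 + 1) → GaugeConfig 3 L SU2) i))) +
        ∑ y : Site 3 L, (2 - ((su2Rep (x.2.2 y * (x'.2.2 y)⁻¹)).trace).re) < ρ) :
    ∃ (s : Fin 3 → Bool), s k₀ = false ∧ ∃ (k : SU2) (t b₁ b₂ : ℝ), |t| < Real.pi / 2 ∧ |Real.sin t| ≤ Real.sqrt ρ ∧ b₁ ^ 2 + b₂ ^ 2 ≤ 225 * ρ ∧
      k * x.2.2 0 * k⁻¹ = seamSlice ωC C₀ t ∧
      k * x.1 ⟨(((fun _ => (-1 : ZMod L)), k₀) : Edge 3 L), not_treeEdge_wrap hL k₀⟩ * k⁻¹ = linkSlice ωN ωX (centreElem (s k₀) * N₀) b₁ b₂ ∧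
      (∀ i : OffIdx L, ‖su2Quat (k * x.1 i * k⁻¹) - su2Quat (combFlat (fun a => centreElem (s a) * (if z a then N₀ else 1)) i.1)‖ ≤ 81 * Real.sqrt ρ) ∧
      (∀ (j : Fin (2 * L - 1)) (e : Edge 3 L),
        ‖su2Quat (k * x.2.1 j e * k⁻¹) - su2Quat (combFlat (fun a => centreElem (s a) * (if z a then N₀ else 1)) e)‖ ≤ 81 * Real.sqrt ρ) ∧
      (∀ y : Site 3 L, ‖su2Quat (k * x.2.2 y * k⁻¹) - su2Quat (lam y * C₀)‖ ≤ 81 * Real.sqrt ρ) := by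
  obtain ⟨s, k', hsrep, hw', hf', hg'⟩ := exists_zero_param_rep hL z hz hk₀ hlamc hlam0 hlamflip hlamstay hN hC hNC x' hx'
  exact ⟨s, hsrep, exists_conj_anchorSlice_of_zero_param hL z hk₀ hlam0 hCω hNω hCN hX hC₀ hN₀ x x' hw' hf' hg' hρ hD⟩

/-! ## §3 Tube membership and the floor with representative classes -/

/-- ★★ **Near a zero, the point lies in a tube of a REPRESENTATIVE class** (`s k₀ = false`).  In the setting of ✓`exists_conj_anchorSlice_of_ringDistSq_lt` (`L ≥ 2`, `z k₀ = true`,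
reference data `(λ, N₀, C₀)` with `su2Quat C₀ = ιω_C`, `su2Quat N₀ = ιω_N`), with bases `Rb s` of the sign classes (`= Q_s` off the anchors): if `x′` is a
zero of `F_fix`, `D(ιx, ιx′) < ρ ≤ 1/1600` and `2·10⁵·L⁴·ρ ≤ R_V²`, then `x = k·fixSlice_s(fixCoord v)` for some `s`, `k ∈ SU(2)`, `‖v‖ ≤ R_V` — i.e. `x` lies
in the tube `Θ_s(SU(2) × B̄(0,R_V))` of ✓`FixSplit.fix_hT`. [cite: Bredon1972, Ch. II §§4–5] -/
theorem exists_mem_fixTube_of_ringDistSq_lt_rep (hL : 2 ≤ L) (z : Fin 3 → Bool) (hz : z ≠ fun _ => false) {k₀ : Fin 3} (hk₀ : z k₀ = true)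
    {lam : Site 3 L → SU2} (hlamc : ∀ x, lam x ∈ Subgroup.center SU2) (hlam0 : lam 0 = 1)
    (hlamflip : ∀ (x : Site 3 L) (k : Fin 3), (x k = 0 ∨ x k = -1) → lam (x.shift k) = lam x * centreElem (z k))
    (hlamstay : ∀ (x : Site 3 L) (k : Fin 3), x k ≠ 0 → x k ≠ -1 → lam (x.shift k) = lam x)
    {N₀ C₀ : SU2} (hN : (su2Quat N₀).re = 0) (hC : (su2Quat C₀).re = 0)
    (hNC : (su2Quat N₀).imI * (su2Quat C₀).imI + (su2Quat N₀).imJ * (su2Quat C₀).imJ + (su2Quat N₀).imK * (su2Quat C₀).imK = 0)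
    {ωC ωN ωX : EuclideanSpace ℝ (Fin 3)} (hCω : ‖ωC‖ = 1) (hNω : ‖ωN‖ = 1) (hCN : ⟪ωC, ωN⟫ = 0) (hX : imQuat ωX = imQuat ωC * imQuat ωN)
    (hC₀ : su2Quat C₀ = imQuat ωC) (hN₀ : su2Quat N₀ = imQuat ωN)
    (Rb : (Fin 3 → Bool) → FixRest L ⟨(((fun _ => (-1 : ZMod L)), k₀) : Edge 3 L), not_treeEdge_wrap hL k₀⟩ 0)
    (hRb1 : ∀ s i, (Rb s).1 i = combFlat (fun a => centreElem (s a) * (if z a then N₀ else 1)) i.1.1)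
    (hRb2 : ∀ s j e, (Rb s).2.1 j e = combFlat (fun a => centreElem (s a) * (if z a then N₀ else 1)) e)
    (hRb3 : ∀ s x, (Rb s).2.2 x = lam x.1 * C₀)
    (x x' : (OffIdx L → SU2) × ((Fin (2 * L - 1) → GaugeConfig 3 L SU2) × (Site 3 L → SU2)))
    (hx' : ringDeficit L z ((Fin.cons (glue x'.1) x'.2.1 : Fin (2 * L - 1 + 1) → GaugeConfig 3 L SU2), x'.2.2) = 0)
    {ρ RV : ℝ} (hρ : ρ ≤ 1 / 1600) (hRV0 : 0 ≤ RV) (hRV : 200000 * (L : ℝ) ^ 4 * ρ ≤ RV ^ 2)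
    (hD : (∑ i : Fin (2 * L - 1 + 1), (6 * (L : ℝ) ^ 3 - timeCoupling su2Rep
        ((Fin.cons (glue x.1) x.2.1 : Fin (2 * L - 1 + 1) → GaugeConfig 3 L SU2) i)
        ((Fin.cons (glue x'.1) x'.2.1 : Fin (2 * L - 1 + 1) → GaugeConfig 3 L SU2) i))) +
        ∑ y : Site 3 L, (2 - ((su2Rep (x.2.2 y * (x'.2.2 y)⁻¹)).trace).re) < ρ) :
    ∃ s : Fin 3 → Bool, s k₀ = false ∧ x ∈ (fun q : SU2 × EuclideanSpace ℝ (Fin (fixDim L ⟨(((fun _ => (-1 : ZMod L)), k₀) : Edge 3 L), not_treeEdge_wrap hL k₀⟩ 0)) =>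
      (((fun i => q.1 * (fixSlice ωC ωN ωX C₀ (centreElem (s k₀) * N₀) (Rb s) (fixCoord q.2)).1 i * q.1⁻¹),
        ((fun j => gaugeTransform (fun _ : Site 3 L => q.1) ((fixSlice ωC ωN ωX C₀ (centreElem (s k₀) * N₀) (Rb s) (fixCoord q.2)).2.1 j)),
          (fun y => q.1 * (fixSlice ωC ωN ωX C₀ (centreElem (s k₀) * N₀) (Rb s) (fixCoord q.2)).2.2 y * q.1⁻¹))) :
        (OffIdx L → SU2) × ((Fin (2 * L - 1) → GaugeConfig 3 L SU2) × (Site 3 L → SU2)))) ''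
      ((univ : Set SU2) ×ˢ closedBall (0 : EuclideanSpace ℝ (Fin (fixDim L ⟨(((fun _ => (-1 : ZMod L)), k₀) : Edge 3 L), not_treeEdge_wrap hL k₀⟩ 0))) RV) := by
  obtain ⟨s, hsrep, k, t, b₁, b₂, htπ, hsin, hb, hseam, hlink, hoff, hslice, hsite⟩ :=
    exists_conj_anchorSlice_of_ringDistSq_lt_rep hL z hz hk₀ hlamc hlam0 hlamflip hlamstay hN hC hNC hCω hNω hCN hX hC₀ hN₀ x x' hx' hρ hD
  -- the translated point `k·x`
  obtain ⟨xt, hxt⟩ : ∃ xt : (OffIdx L → SU2) × ((Fin (2 * L - 1) → GaugeConfig 3 L SU2) × (Site 3 L → SU2)),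
      xt = ((fun i => k * x.1 i * k⁻¹), ((fun j => gaugeTransform (fun _ : Site 3 L => k) (x.2.1 j)), (fun y => k * x.2.2 y * k⁻¹))) := ⟨_, rfl⟩
  have hxt1 : ∀ i, xt.1 i = k * x.1 i * k⁻¹ := fun i => by rw [hxt]
  have hxt2 : ∀ j e, xt.2.1 j e = k * x.2.1 j e * k⁻¹ := fun j e => by rw [hxt]; rfl
  have hxt3 : ∀ y, xt.2.2 y = k * x.2.2 y * k⁻¹ := fun y => by rw [hxt]
  have hρ0 : 0 ≤ ρ := by
    have h0 := norm_sq_site_le_ringDistSq x x' 0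
    nlinarith [sq_nonneg ‖su2Quat (x.2.2 0) - su2Quat (x'.2.2 0)‖]
  have hsρ0 : 0 ≤ Real.sqrt ρ := Real.sqrt_nonneg ρ
  -- the slice coordinates of `k·x`
  obtain ⟨yc, hyc⟩ : ∃ yc : EuclideanSpace ℝ (Fin 3) × RestParam L ⟨(((fun _ => (-1 : ZMod L)), k₀) : Edge 3 L), not_treeEdge_wrap hL k₀⟩ 0,
      yc = (toLp 2 ![t, b₁, b₂],
        ((fun i => logVec (su2Quat (xt.1 i.1 * ((Rb s).1 i)⁻¹))),
          ((fun j e => logVec (su2Quat (xt.2.1 j e * ((Rb s).2.1 j e)⁻¹))), fun y => logVec (su2Quat (xt.2.2 y.1 * ((Rb s).2.2 y)⁻¹))))) :=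
    ⟨_, rfl⟩
  have hσ : fixSlice ωC ωN ωX C₀ (centreElem (s k₀) * N₀) (Rb s) yc = xt := by
    rw [hyc]; exact fixSlice_logCoords_eq ωC ωN ωX C₀ _ (Rb s) xt (by rw [hxt3]; exact hseam) (by rw [hxt1]; exact hlink)
  obtain ⟨v, hv⟩ := exists_fixCoord_eq yc
  -- the size of the coordinates
  have hvn : ‖v‖ ^ 2 ≤ 200000 * (L : ℝ) ^ 4 * ρ := by
    refine norm_sq_le_of_logCoords (Rb s) xt hρ0 htπ hsin hb (fun i => ?_) (fun j e => ?_) (fun y => ?_) v (by rw [hv, hyc])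
    · rw [hRb1, hxt1]; exact hoff i.1
    · rw [hRb2, hxt2]; exact hslice j e
    · rw [hRb3, hxt3]; exact hsite y.1
  have hvR : ‖v‖ ≤ RV := by
    refine (pow_le_pow_iff_left₀ (norm_nonneg v) hRV0 two_ne_zero).mp ?_
    exact hvn.trans hRV
  -- `x = k⁻¹ · (k·x)`
  refine ⟨s, hsrep, ⟨(k⁻¹, v), ⟨mem_univ _, mem_closedBall_zero_iff.mpr hvR⟩, ?_⟩⟩
  dsimp only
  rw [hv, hσ, hxt]
  refine Prod.ext ?_ (Prod.ext ?_ ?_)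
  · funext i; dsimp only; rw [inv_inv]; group
  · funext j e
    show k⁻¹ * (k * x.2.1 j e * k⁻¹) * k⁻¹⁻¹ = x.2.1 j e
    rw [inv_inv]; group
  · funext y; dsimp only; rw [inv_inv]; group

/-- ★★ **The floor off the FOUR representative tubes (`hfloor` of ✓`sharpTwistedLaplace_of_fixTubes` with `ι = {s // s k₀ = false}`).**  With the constants `K, q, L₀` of ✓`QuantitativeLaplace.ringDeficit_fix_floor`:
for `L ≥ max(L₀, 2)`, `z ≠ 0`, reference data as in ✓`exists_mem_fixTube_of_ringDistSq_lt`, and radii `0 < ρ ≤ 1/1600`, `2·10⁵·L⁴·ρ ≤ R_V²`, every `x ∈ X_fix`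
outside ALL the tubes `Θ_s(SU(2) × B̄(0,R_V))` has `F_fix(x) ≥ min((K·L^q)⁻¹, ρ/(1010·L⁶·K·L^q))`. [cite: Bredon1972, Ch. II §§4–5] [cite: Luscher1983, §2] -/
theorem ringDeficit_fix_floor_off_repTubes :
    ∃ K : ℝ, 0 < K ∧ ∃ q : ℝ, 0 ≤ q ∧ ∃ L₀ : ℕ, ∀ (L : ℕ) [NeZero L] (hL₀ : L₀ ≤ L) (hL : 2 ≤ L) (z : Fin 3 → Bool) (hz : z ≠ fun _ => false)
      {k₀ : Fin 3} (hk₀ : z k₀ = true)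
      {lam : Site 3 L → SU2} (hlamc : ∀ x, lam x ∈ Subgroup.center SU2) (hlam0 : lam 0 = 1)
      (hlamflip : ∀ (x : Site 3 L) (k : Fin 3), (x k = 0 ∨ x k = -1) → lam (x.shift k) = lam x * centreElem (z k))
      (hlamstay : ∀ (x : Site 3 L) (k : Fin 3), x k ≠ 0 → x k ≠ -1 → lam (x.shift k) = lam x)
      {N₀ C₀ : SU2} (hN : (su2Quat N₀).re = 0) (hC : (su2Quat C₀).re = 0)
      (hNC : (su2Quat N₀).imI * (su2Quat C₀).imI + (su2Quat N₀).imJ * (su2Quat C₀).imJ + (su2Quat N₀).imK * (su2Quat C₀).imK = 0)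
      {ωC ωN ωX : EuclideanSpace ℝ (Fin 3)} (hCω : ‖ωC‖ = 1) (hNω : ‖ωN‖ = 1) (hCN : ⟪ωC, ωN⟫ = 0) (hX : imQuat ωX = imQuat ωC * imQuat ωN)
      (hC₀ : su2Quat C₀ = imQuat ωC) (hN₀ : su2Quat N₀ = imQuat ωN)
      (Rb : (Fin 3 → Bool) → FixRest L ⟨(((fun _ => (-1 : ZMod L)), k₀) : Edge 3 L), not_treeEdge_wrap hL k₀⟩ 0)
      (hRb1 : ∀ s i, (Rb s).1 i = combFlat (fun a => centreElem (s a) * (if z a then N₀ else 1)) i.1.1)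
      (hRb2 : ∀ s j e, (Rb s).2.1 j e = combFlat (fun a => centreElem (s a) * (if z a then N₀ else 1)) e)
      (hRb3 : ∀ s x, (Rb s).2.2 x = lam x.1 * C₀)
      {ρ RV : ℝ} (hρ0 : 0 < ρ) (hρ : ρ ≤ 1 / 1600) (hRV0 : 0 ≤ RV) (hRV : 200000 * (L : ℝ) ^ 4 * ρ ≤ RV ^ 2)
      (x : (OffIdx L → SU2) × ((Fin (2 * L - 1) → GaugeConfig 3 L SU2) × (Site 3 L → SU2))),
      (∀ s : Fin 3 → Bool, s k₀ = false → x ∉ (fun q : SU2 × EuclideanSpace ℝ (Fin (fixDim L ⟨(((fun _ => (-1 : ZMod L)), k₀) : Edge 3 L), not_treeEdge_wrap hL k₀⟩ 0)) =>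
        (((fun i => q.1 * (fixSlice ωC ωN ωX C₀ (centreElem (s k₀) * N₀) (Rb s) (fixCoord q.2)).1 i * q.1⁻¹),
          ((fun j => gaugeTransform (fun _ : Site 3 L => q.1) ((fixSlice ωC ωN ωX C₀ (centreElem (s k₀) * N₀) (Rb s) (fixCoord q.2)).2.1 j)),
            (fun y => q.1 * (fixSlice ωC ωN ωX C₀ (centreElem (s k₀) * N₀) (Rb s) (fixCoord q.2)).2.2 y * q.1⁻¹))) :
          (OffIdx L → SU2) × ((Fin (2 * L - 1) → GaugeConfig 3 L SU2) × (Site 3 L → SU2)))) ''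
        ((univ : Set SU2) ×ˢ closedBall (0 : EuclideanSpace ℝ (Fin (fixDim L ⟨(((fun _ => (-1 : ZMod L)), k₀) : Edge 3 L), not_treeEdge_wrap hL k₀⟩ 0))) RV)) →
      min (K * (L : ℝ) ^ q)⁻¹ (ρ / (1010 * (L : ℝ) ^ 6 * (K * (L : ℝ) ^ q))) ≤
        ringDeficit L z ((Fin.cons (glue x.1) x.2.1 : Fin (2 * L - 1 + 1) → GaugeConfig 3 L SU2), x.2.2) := by
  obtain ⟨K, hK, q, hq, L₀, hfloor⟩ := QuantitativeLaplace.ringDeficit_fix_floor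
  refine ⟨K, hK, q, hq, L₀, ?_⟩
  intro L _ hL₀ hL z hz k₀ hk₀ lam hlamc hlam0 hlamflip hlamstay N₀ C₀ hN hC hNC ωC ωN ωX hCω hNω hCN hX hC₀ hN₀ Rb hRb1 hRb2 hRb3 ρ RV hρ0 hρ hRV0
    hRV x hout
  refine hfloor L hL₀ z hz ρ hρ0 x (le_csInf ?_ ?_)
  · -- the zero set is non-empty
    refine ⟨_, ⟨((fun i : OffIdx L => combFlat (fun a => centreElem (false) * (if z a then N₀ else 1)) i.1),
      ((fun _ : Fin (2 * L - 1) => combFlat (fun a => centreElem (false) * (if z a then N₀ else 1))), fun y : Site 3 L => lam y * C₀)), ?_, rfl⟩⟩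
    exact ringDeficit_fix_reference_eq_zero hL z hlamc hlamflip hlamstay hN hC hNC (fun _ => false)
  · rintro d ⟨x', hx', rfl⟩
    by_contra hlt
    push Not at hlt
    obtain ⟨s, hsrep, hs⟩ := exists_mem_fixTube_of_ringDistSq_lt_rep hL z hz hk₀ hlamc hlam0 hlamflip hlamstay hN hC hNC hCω hNω hCN hX hC₀ hN₀ Rb hRb1 hRb2 hRb3
      x x' hx' hρ hRV0 hRV hlt
    exact hout s hsrep hs

end Summit.QuantumFields.YangMills.Theorems.VirialFluxGap.AnchorSlice
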